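import Summits.KontsevichZagierPeriods.KontsevichZagierPeriods.Theorems.RootDecompRelativeModAbsoluteRegFoldingDegOneP07

/-!
# `RegFoldingDegOne` (route `RootDecompRelativeModAbsolute`, support item stmt-KontsevichZagierPeriods-30571) — PROVED · part 8/14

Cell `decomp-kz`, lens 3 (decomp-kz-lens-3 g9): `regFoldingDegOne_holds :
Theses.RootDecompRelativeModAbsolute.RegFoldingDegOne` BY NAME (in part 14/14) — every Kontsevich–Zagier
integral representation on `ℝ²` whose integrand is a quotient `p/q` of `ℚ`-polynomials with `deg_t q ≤ 1`,
`q ≠ 0` on the domain, is equivalent in `KZ.relations` to `[g] + Σᵢ [Uᵢ]`, the `Uᵢ` honest 2-cells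
`[g.domain × (0,1), hᵢ(x) θ^{Mᵢ}/(1 + θ^{eᵢ} κᵢ(x))]` (unfolded REGULARISED log/arctan monomials), with the
fibre integrals matching a.e.  Architecture: §1–§2 regularised terms `RTerm`, `RegFolding d`; §7 a.e.-congruence;
§8 gluing (`FoldsTo`); §9 one-band toolkit; §P analytic core (kernel independence); §10 cylinders; §11 affine band
chart; §13 `RegFolding 1` from a CAD band cover a.e. + vanishing on unbounded bands; last part: the edge to the born
item text and `regFoldingDegOne_holds`.

Source: `HOME/decomp-kz-lens-3/g9/landing/RootDecompRelativeModAbsoluteRegFoldingDegOne.lean` sha256 60038aa44a5f6303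
(4275 l; critic decomp-kz-crit-1 g2 CLEARED/kernel-confirmed 2026-08-30T09:41:19Z, std axioms), split mechanically
into 14 modules ≤ 400 lines by the landing seat decomp-kz-census-1 g7 (contexts re-opened per part; generic docstrings
added where the source had none; parts 1–13 do not import the route file).  No `sorry`; standard axioms.
References: [cite: KontsevichZagier2001, §1.2]; Basu–Pollack–Roy 2006 Def. 5.1 / Cor. 5.7; Bochnak–Coste–Roy 1998 §2.9.
-/

noncomputable section

open Set MeasureTheory Filter Topology
open scoped BigOperators
open Literature.NumberTheory.Transcendental Literature.ModelTheory.ExponentialFields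

namespace Summit.KontsevichZagierPeriods.RootDecompRelativeModAbsolute.Rung30571

namespace RegularisedLogLayer

namespace Plan

section Away

variable {m : ℕ}

/-- **End `κ → +∞`** (case C: concentration at `θ = 0`). -/
theorem away_large (m : ℕ) : ∃ K : ℝ, 0 < K ∧ ∃ c : ℝ, 0 < c ∧ ∀ κ : ℝ, K ≤ κ →
    ∀ (a : Fin (m + 1) → ℝ) (b : ℝ),
      c * (∑ k, |a k| + |b| * ell0 κ) ≤ ∫ θ in Ioo (0 : ℝ) 1, |gFun κ a b θ| := by
  obtain ⟨c₁, hc₁, hpoly⟩ :=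
    poly_l1_lower_on m (u := 1 / 2) (v := 1) (by norm_num) (by norm_num) le_rfl
  refine ⟨Real.exp (4 / c₁), Real.exp_pos _, min (c₁ / 6) (1 / 3), by positivity,
    fun κ hκK a b => ?_⟩
  have hκ0 : 0 < κ := (Real.exp_pos _).trans_le hκK
  have hκ : -1 < κ := by linarith
  have hlog : 4 / c₁ ≤ Real.log (1 + κ) := by
    rw [Real.le_log_iff_exp_le (by linarith)]
    linarith
  have hell : ell0 κ = Real.log (1 + κ) / κ := ell0_eq hκ hκ0.ne'
  have hA0 : 0 ≤ ∑ k, |a k| := Finset.sum_nonneg fun k _ => abs_nonneg _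
  have hB0 : 0 ≤ |b| * ell0 κ := mul_nonneg (abs_nonneg b) (ell0_nonneg hκ)
  have hK : ∀ θ ∈ Ioo (1 / 2 : ℝ) 1, 1 / (1 + κ * θ) ≤ 1 / (1 + κ / 2) := fun θ hθ =>
    one_div_le_one_div_of_le (by positivity) (by nlinarith [hθ.1])
  have h2 := integral_gFun_ge_poly hκ a b (u := 1 / 2) (v := 1) (by norm_num) (by norm_num) le_rfl hK
  have hP : c₁ * ∑ k, |a k| ≤ N (1 / 2) 1 a := hpoly a
  have hone : 1 ≤ c₁ / 4 * Real.log (1 + κ) := by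
    have h := hlog
    rw [div_le_iff₀ hc₁] at h
    nlinarith
  have h3 : 1 / (2 + κ) ≤ c₁ / 4 * ell0 κ := by
    rw [hell, div_le_iff₀ (by linarith : (0 : ℝ) < 2 + κ)]
    have h4 : 1 ≤ (2 + κ) / κ := by
      rw [le_div_iff₀ hκ0]
      linarith
    have h5 : c₁ / 4 * (Real.log (1 + κ) / κ) * (2 + κ) =
        (c₁ / 4 * Real.log (1 + κ)) * ((2 + κ) / κ) := by ring
    rw [h5]
    exact one_le_mul_of_one_le_of_one_le hone h4
  have htail : (1 - 1 / 2) * (|b| * (1 / (1 + κ / 2))) ≤ c₁ / 4 * (|b| * ell0 κ) := by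
    have h1 : (1 - 1 / 2) * (|b| * (1 / (1 + κ / 2))) = |b| * (1 / (2 + κ)) := by
      field_simp
      ring
    rw [h1]
    calc |b| * (1 / (2 + κ)) ≤ |b| * (c₁ / 4 * ell0 κ) :=
          mul_le_mul_of_nonneg_left h3 (abs_nonneg b)
      _ = c₁ / 4 * (|b| * ell0 κ) := by ring
  have h3' := integral_gFun_ge_ker hκ a b
  exact away_algebra hc₁.le hA0 hB0 (by linarith) (by linarith)

/-- **End `κ → -1`** (case D: concentration at `θ = 1`). -/
theorem away_negOne (m : ℕ) : ∃ ε : ℝ, 0 < ε ∧ ∃ c : ℝ, 0 < c ∧ ∀ κ : ℝ, -1 < κ → κ ≤ -1 + ε →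
    ∀ (a : Fin (m + 1) → ℝ) (b : ℝ),
      c * (∑ k, |a k| + |b| * ell0 κ) ≤ ∫ θ in Ioo (0 : ℝ) 1, |gFun κ a b θ| := by
  obtain ⟨c₂, hc₂, hpoly⟩ :=
    poly_l1_lower_on m (u := 0) (v := 1 / 2) le_rfl (by norm_num) (by norm_num)
  refine ⟨min (Real.exp (-(4 / c₂))) (1 / 2), by positivity, min (c₂ / 6) (1 / 3), by positivity,
    fun κ hκ hκε a b => ?_⟩
  have hm1 := min_le_left (Real.exp (-(4 / c₂))) (1 / 2)
  have hm2 := min_le_right (Real.exp (-(4 / c₂))) (1 / 2)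
  have hκneg : κ < 0 := by linarith
  have hlog : Real.log (1 + κ) ≤ -(4 / c₂) := by
    rw [Real.log_le_iff_le_exp (by linarith)]
    linarith
  have hell : ell0 κ = Real.log (1 + κ) / κ := ell0_eq hκ hκneg.ne
  have hell4 : 4 / c₂ ≤ ell0 κ := by
    rw [hell, le_div_iff_of_neg hκneg]
    have h4 : 0 < 4 / c₂ := by positivity
    nlinarith
  have hA0 : 0 ≤ ∑ k, |a k| := Finset.sum_nonneg fun k _ => abs_nonneg _
  have hB0 : 0 ≤ |b| * ell0 κ := mul_nonneg (abs_nonneg b) (ell0_nonneg hκ)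
  have hK : ∀ θ ∈ Ioo (0 : ℝ) (1 / 2), 1 / (1 + κ * θ) ≤ 2 := fun θ hθ => by
    have hθ' : θ ∈ Icc (0 : ℝ) 1 := ⟨hθ.1.le, by linarith [hθ.2]⟩
    rw [div_le_iff₀ (one_add_mul_pos hκ hθ')]
    nlinarith [mul_nonneg (by linarith : (0 : ℝ) ≤ -κ) (by linarith [hθ.2] : (0 : ℝ) ≤ 1 / 2 - θ)]
  have h2 := integral_gFun_ge_poly hκ a b (u := 0) (v := 1 / 2) le_rfl (by norm_num) (by norm_num) hK
  have hP : c₂ * ∑ k, |a k| ≤ N 0 (1 / 2) a := hpoly a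
  have hone : 1 ≤ c₂ / 4 * ell0 κ := by
    have h := hell4
    rw [div_le_iff₀ hc₂] at h
    nlinarith
  have htail : (1 / 2 - 0) * (|b| * 2) ≤ c₂ / 4 * (|b| * ell0 κ) := by
    have h1 : (1 / 2 - 0) * (|b| * 2) = |b| := by ring
    rw [h1]
    nlinarith [abs_nonneg b]
  have h3' := integral_gFun_ge_ker hκ a b
  exact away_algebra hc₂.le hA0 hB0 (by linarith) (by linarith)

/-- `1/(1+κθ)` is not a polynomial on `(0,1)` (`κ ≠ 0`): a vanishing `gFun` has zero data. -/
theorem eq_zero_of_gFun_eq_zero {κ : ℝ} (hκ : -1 < κ) (hκ0 : κ ≠ 0) {a : Fin (m + 1) → ℝ} {b : ℝ}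
    (h : ∀ θ ∈ Ioo (0 : ℝ) 1, gFun κ a b θ = 0) : a = 0 ∧ b = 0 := by
  set L : Polynomial ℝ := Polynomial.C κ * Polynomial.X + Polynomial.C 1 with hL
  set R : Polynomial ℝ := polyOf a * L + Polynomial.C b with hR
  have hev : ∀ θ ∈ Ioo (0 : ℝ) 1, R.eval θ = 0 := by
    intro θ hθ
    have hd := one_add_mul_pos hκ (Ioo_subset_Icc_self hθ)
    have h1 := h θ hθ
    unfold gFun at h1
    have h2 : polyFun a θ * (1 + κ * θ) + b = 0 := by
      have hd' : 1 + κ * θ ≠ 0 := hd.ne'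
      have e : b = b / (1 + κ * θ) * (1 + κ * θ) := by field_simp
      rw [e, ← add_mul, h1, zero_mul]
    have e : R.eval θ = polyFun a θ * (1 + κ * θ) + b := by
      simp only [hR, hL, Polynomial.eval_add, Polynomial.eval_mul, eval_polyOf, Polynomial.eval_C,
        Polynomial.eval_X]
      ring
    rw [e, h2]
  have hroots : Set.Infinite {θ : ℝ | R.IsRoot θ} :=
    (Ioo_infinite (zero_lt_one' ℝ)).mono fun θ hθ => by
      simp only [mem_setOf_eq, Polynomial.IsRoot, hev θ hθ]
  have hR0 : R = 0 := Polynomial.eq_zero_of_infinite_isRoot _ hroots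
  by_cases hP : polyOf a = 0
  · refine ⟨eq_zero_of_polyOf_eq_zero a hP, ?_⟩
    have : Polynomial.C b = 0 := by simpa [hR, hP] using hR0
    exact Polynomial.C_eq_zero.1 this
  · exfalso
    have hLne : L ≠ 0 := by
      intro h0
      have := Polynomial.natDegree_linear (b := (1 : ℝ)) hκ0
      rw [← hL, h0, Polynomial.natDegree_zero] at this
      exact zero_ne_one this
    have hdeg : (polyOf a * L).natDegree = (polyOf a).natDegree + 1 := by
      rw [Polynomial.natDegree_mul hP hLne, hL, Polynomial.natDegree_linear hκ0]
    have hmul : polyOf a * L = -Polynomial.C b := eq_neg_of_add_eq_zero_left hR0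
    rw [hmul, Polynomial.natDegree_neg, Polynomial.natDegree_C] at hdeg
    omega

/-- joint continuity of `(κ, a, b) ↦ ∫₀¹ |gFun κ a b|` at points with `κ > -1`. -/
theorem continuousAt_integral_gFun {p₀ : ℝ × ((Fin (m + 1) → ℝ) × ℝ)} (hp₀ : -1 < p₀.1) :
    ContinuousAt (fun p : ℝ × ((Fin (m + 1) → ℝ) × ℝ) =>
      ∫ θ in Ioo (0 : ℝ) 1, |gFun p.1 p.2.1 p.2.2 θ|) p₀ := by
  set r₀ : ℝ := (1 + p₀.1) / 2 with hr₀
  have hr₀0 : 0 < r₀ := by rw [hr₀]; linarith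
  set r : ℝ := min r₀ 1 with hr
  have hr0 : 0 < r := by positivity
  have hball : ∀ᶠ p in 𝓝 p₀, dist p p₀ < r := Metric.ball_mem_nhds p₀ hr0
  -- what membership in the ball gives
  have hin : ∀ p : ℝ × ((Fin (m + 1) → ℝ) × ℝ), dist p p₀ < r →
      r₀ < 1 + p.1 ∧ (∀ k, |p.2.1 k| ≤ |p₀.2.1 k| + 1) ∧ |p.2.2| ≤ |p₀.2.2| + 1 := by
    intro p hp
    have hp1 : dist p.1 p₀.1 ≤ dist p p₀ := by rw [Prod.dist_eq]; exact le_max_left _ _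
    have hp2 : dist p.2 p₀.2 ≤ dist p p₀ := by rw [Prod.dist_eq]; exact le_max_right _ _
    have hp21 : dist p.2.1 p₀.2.1 ≤ dist p.2 p₀.2 := by
      rw [Prod.dist_eq (x := p.2)]; exact le_max_left _ _
    have hp22 : dist p.2.2 p₀.2.2 ≤ dist p.2 p₀.2 := by
      rw [Prod.dist_eq (x := p.2)]; exact le_max_right _ _
    have hr1 : r ≤ r₀ := min_le_left _ _
    have hr2 : r ≤ 1 := min_le_right _ _
    refine ⟨?_, fun k => ?_, ?_⟩
    · have := hp1.trans_lt hp
      rw [Real.dist_eq] at this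
      have := abs_lt.1 this
      linarith [this.1]
    · have hk : dist (p.2.1 k) (p₀.2.1 k) ≤ dist p.2.1 p₀.2.1 := dist_le_pi_dist _ _ k
      rw [Real.dist_eq] at hk
      have := abs_sub_abs_le_abs_sub (p.2.1 k) (p₀.2.1 k)
      linarith
    · rw [Real.dist_eq] at hp22
      have := abs_sub_abs_le_abs_sub p.2.2 p₀.2.2
      linarith
  set Kk : ℝ := 1 / min r₀ 1 with hKk
  have hmin0 : 0 < min r₀ 1 := by positivity
  set Bd : ℝ := ∑ k : Fin (m + 1), (|p₀.2.1 k| + 1) + (|p₀.2.2| + 1) * Kk with hBd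
  refine MeasureTheory.continuousAt_of_dominated (bound := fun _ => Bd) ?_ ?_ ?_ ?_
  · filter_upwards [hball] with p hp
    have hp1 : -1 < p.1 := by linarith [(hin p hp).1]
    exact ((continuousOn_gFun hp1 p.2.1 p.2.2).mono Ioo_subset_Icc_self).aestronglyMeasurable
      measurableSet_Ioo
  · filter_upwards [hball] with p hp
    obtain ⟨hp1, hpa, hpb⟩ := hin p hp
    have hp1' : -1 < p.1 := by linarith
    refine (ae_restrict_mem measurableSet_Ioo).mono fun θ hθ => ?_
    have hθ' := Ioo_subset_Icc_self hθ
    rw [Real.norm_eq_abs, abs_abs]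
    have hd := one_add_mul_pos hp1' hθ'
    have hker : 1 / (1 + p.1 * θ) ≤ Kk := by
      refine one_div_le_one_div_of_le hmin0 ?_
      have := one_add_min_le (κ := p.1) hθ'
      have h2 : min r₀ 1 ≤ 1 + min p.1 0 := by
        rcases le_or_gt 0 p.1 with h | h
        · rw [min_eq_right h]; simp
        · rw [min_eq_left h.le]; exact (min_le_left _ _).trans (by linarith)
      linarith
    calc |gFun p.1 p.2.1 p.2.2 θ| ≤ |polyFun p.2.1 θ| + |p.2.2 / (1 + p.1 * θ)| := abs_add_le _ _
      _ ≤ ∑ k, |p.2.1 k| + |p.2.2| * (1 / (1 + p.1 * θ)) := by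
          rw [abs_div, abs_of_pos hd, ← mul_one_div]
          exact add_le_add (abs_polyFun_le _ hθ') le_rfl
      _ ≤ Bd := by
          refine add_le_add (Finset.sum_le_sum fun k _ => hpa k) ?_
          exact mul_le_mul hpb hker (one_div_pos.2 hd).le (by positivity)
  · exact integrableOn_const_Ioo 0 1 _
  · refine (ae_restrict_mem measurableSet_Ioo).mono fun θ hθ => ?_
    have hd := one_add_mul_pos hp₀ (Ioo_subset_Icc_self hθ)
    have h1 : Continuous fun p : ℝ × ((Fin (m + 1) → ℝ) × ℝ) => polyFun p.2.1 θ :=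
      (continuous_polyFun_coeff θ).comp (continuous_fst.comp continuous_snd)
    have h2 : ContinuousAt (fun p : ℝ × ((Fin (m + 1) → ℝ) × ℝ) => p.2.2 / (1 + p.1 * θ)) p₀ :=
      ContinuousAt.div (by fun_prop) (by fun_prop) hd.ne'
    exact (continuous_abs.continuousAt).comp (h1.continuousAt.add h2)

/-- **Compact middle** (case A): `κ ∈ [κ₁, κ₂]` with `κ₁ > -1` and `0 ∉ [κ₁, κ₂]`. -/
theorem away_middle (m : ℕ) {κ₁ κ₂ : ℝ} (hκ₁ : -1 < κ₁) (h0 : 0 < κ₁ ∨ κ₂ < 0) :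
    ∃ c : ℝ, 0 < c ∧ ∀ κ ∈ Icc κ₁ κ₂, ∀ (a : Fin (m + 1) → ℝ) (b : ℝ),
      c * (∑ k, |a k| + |b| * ell0 κ) ≤ ∫ θ in Ioo (0 : ℝ) 1, |gFun κ a b θ| := by
  rcases (Icc κ₁ κ₂).eq_empty_or_nonempty with he | ⟨κ₀, hκ₀⟩
  · exact ⟨1, one_pos, fun κ hκ => by simp [he] at hκ⟩
  have hκ_of : ∀ κ ∈ Icc κ₁ κ₂, -1 < κ ∧ κ ≠ 0 := fun κ hκ =>
    ⟨hκ₁.trans_le hκ.1, by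
      rcases h0 with h | h
      · exact ((h.trans_le hκ.1)).ne'
      · exact (hκ.2.trans_lt h).ne⟩
  set S : Set ((Fin (m + 1) → ℝ) × ℝ) := {q | ∑ k, |q.1 k| + |q.2| = 1} with hS
  have hSc : IsCompact S := by
    refine Metric.isCompact_of_isClosed_isBounded ?_ ?_
    · exact isClosed_eq (by fun_prop) continuous_const
    · refine (Metric.isBounded_closedBall (x := (0 : (Fin (m + 1) → ℝ) × ℝ)) (r := 1)).subset ?_
      intro q hq
      have hq' : ∑ k, |q.1 k| + |q.2| = 1 := hq
      have hqa : ∀ k, |q.1 k| ≤ 1 := fun k => by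
        have := Finset.single_le_sum (f := fun k => |q.1 k|) (fun k _ => abs_nonneg _)
          (Finset.mem_univ k)
        linarith [abs_nonneg q.2]
      have hqb : |q.2| ≤ 1 := by
        linarith [Finset.sum_nonneg fun k (_ : k ∈ Finset.univ) => abs_nonneg (q.1 k)]
      rw [Metric.mem_closedBall, dist_zero_right, Prod.norm_def, max_le_iff,
        pi_norm_le_iff_of_nonneg zero_le_one, Real.norm_eq_abs]
      exact ⟨fun k => by rw [Real.norm_eq_abs]; exact hqa k, hqb⟩
  have hTc : IsCompact (Icc κ₁ κ₂ ×ˢ S) := isCompact_Icc.prod hSc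
  have hTne : (Icc κ₁ κ₂ ×ˢ S).Nonempty := by
    refine ⟨(κ₀, (Pi.single 0 1, 0)), hκ₀, ?_⟩
    simp only [hS, mem_setOf_eq, abs_zero, add_zero]
    rw [Finset.sum_eq_single 0]
    · simp
    · intro k _ hk
      simp [hk]
    · simp
  set Φ : ℝ × ((Fin (m + 1) → ℝ) × ℝ) → ℝ :=
    fun p => ∫ θ in Ioo (0 : ℝ) 1, |gFun p.1 p.2.1 p.2.2 θ| with hΦ
  have hcont : ContinuousOn Φ (Icc κ₁ κ₂ ×ˢ S) := fun p hp =>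
    (continuousAt_integral_gFun (m := m) (hκ_of p.1 hp.1).1).continuousWithinAt
  obtain ⟨p₀, hp₀T, hmin⟩ := hTc.exists_isMinOn hTne hcont
  obtain ⟨hp₀1, hp₀2⟩ := hp₀T
  have hp₀S : ∑ k, |p₀.2.1 k| + |p₀.2.2| = 1 := hp₀2
  obtain ⟨hκp, hκp0⟩ := hκ_of p₀.1 hp₀1
  have hΦpos : 0 < Φ p₀ := by
    refine (integral_gFun_nonneg p₀.1 p₀.2.1 p₀.2.2).lt_of_ne fun h0 => ?_
    have hae : (fun θ => |gFun p₀.1 p₀.2.1 p₀.2.2 θ|) =ᵐ[volume.restrict (Ioo (0 : ℝ) 1)] 0 := by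
      refine (integral_eq_zero_iff_of_nonneg_ae ?_ (integrableOn_gFun hκp _ _)).1 h0.symm
      exact Eventually.of_forall fun θ => abs_nonneg _
    have hEq : EqOn (fun θ => |gFun p₀.1 p₀.2.1 p₀.2.2 θ|) 0 (Ioo (0 : ℝ) 1) :=
      Measure.eqOn_open_of_ae_eq hae isOpen_Ioo
        ((continuousOn_gFun hκp _ _).mono Ioo_subset_Icc_self) continuousOn_const
    obtain ⟨ha, hb⟩ := eq_zero_of_gFun_eq_zero hκp hκp0 fun θ hθ => abs_eq_zero.1 (hEq hθ)
    rw [ha, hb] at hp₀S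
    simp at hp₀S
  -- the uniform upper bound for `ℓ₀` on `[κ₁, κ₂]`
  have hL0 : 0 < 1 + min κ₁ 0 := by
    have : -1 < min κ₁ 0 := lt_min hκ₁ (by norm_num)
    linarith
  set L : ℝ := 1 / (1 + min κ₁ 0) with hL
  have hL1 : 1 ≤ L := one_le_one_div hL0 (by simp)
  have hLpos : 0 < L := one_div_pos.2 hL0
  have hellL : ∀ κ ∈ Icc κ₁ κ₂, ell0 κ ≤ L := fun κ hκ =>
    (ell0_le (hκ_of κ hκ).1).trans
      (one_div_le_one_div_of_le hL0 (by linarith [min_le_min_right 0 hκ.1]))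
  refine ⟨Φ p₀ / L, div_pos hΦpos hLpos, fun κ hκ a b => ?_⟩
  have hA0 : 0 ≤ ∑ k, |a k| := Finset.sum_nonneg fun k _ => abs_nonneg _
  rcases eq_or_lt_of_le (add_nonneg hA0 (abs_nonneg b)) with hs | hs
  · -- `a = 0`, `b = 0`
    have hb : |b| = 0 := by linarith [abs_nonneg b]
    have ha : ∑ k, |a k| = 0 := by linarith
    rw [ha, hb, zero_add, zero_mul, mul_zero]
    exact integral_gFun_nonneg κ a b
  · set s : ℝ := ∑ k, |a k| + |b| with hsdef
    have hmem : (κ, ((fun k => a k / s), b / s)) ∈ Icc κ₁ κ₂ ×ˢ S := by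
      refine ⟨hκ, ?_⟩
      simp only [hS, mem_setOf_eq, abs_div, abs_of_pos hs]
      rw [← Finset.sum_div, ← add_div, div_self hs.ne']
    have h1 : Φ p₀ ≤ Φ (κ, ((fun k => a k / s), b / s)) := hmin hmem
    have h2 : Φ (κ, ((fun k => a k / s), b / s)) = (∫ θ in Ioo (0 : ℝ) 1, |gFun κ a b θ|) / s :=
      integral_gFun_smul κ a b hs
    rw [h2, le_div_iff₀ hs] at h1
    -- `Φ p₀ / L · (A + |b| ℓ₀) ≤ Φ p₀ · (A + |b|) ≤ ∫ |g|`
    have e1 : Φ p₀ / L * ∑ k, |a k| ≤ Φ p₀ * ∑ k, |a k| :=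
      mul_le_mul_of_nonneg_right (div_le_self hΦpos.le hL1) hA0
    have e2 : Φ p₀ / L * (|b| * ell0 κ) ≤ Φ p₀ * |b| := by
      have : |b| * ell0 κ ≤ |b| * L := mul_le_mul_of_nonneg_left (hellL κ hκ) (abs_nonneg b)
      calc Φ p₀ / L * (|b| * ell0 κ) ≤ Φ p₀ / L * (|b| * L) :=
            mul_le_mul_of_nonneg_left this (div_pos hΦpos hLpos).le
        _ = Φ p₀ * |b| := by field_simp
    calc Φ p₀ / L * (∑ k, |a k| + |b| * ell0 κ)
        = Φ p₀ / L * ∑ k, |a k| + Φ p₀ / L * (|b| * ell0 κ) := mul_add _ _ _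
      _ ≤ Φ p₀ * ∑ k, |a k| + Φ p₀ * |b| := add_le_add e1 e2
      _ = Φ p₀ * s := by rw [hsdef, mul_add]
      _ ≤ ∫ θ in Ioo (0 : ℝ) 1, |gFun κ a b θ| := h1

/-- **Cases A, C, D of the endpoint analysis, PROVED for every degree and every `η > 0`.** -/
theorem kernelIndependenceAway (m : ℕ) {η : ℝ} (hη : 0 < η) : KernelIndependenceAway m η := by
  obtain ⟨K, hK, cL, hcL, hL⟩ := away_large m
  obtain ⟨ε, hε, cN, hcN, hN⟩ := away_negOne m
  obtain ⟨cM₁, hcM₁, hM₁⟩ := away_middle m (κ₁ := η) (κ₂ := K) (by linarith) (Or.inl hη)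
  obtain ⟨cM₂, hcM₂, hM₂⟩ :=
    away_middle m (κ₁ := -1 + ε) (κ₂ := -η) (by linarith) (Or.inr (by linarith))
  refine ⟨min (min cL cN) (min cM₁ cM₂), by positivity, fun κ hκ hηκ a b => ?_⟩
  have hX : 0 ≤ ∑ k, |a k| + |b| * ell0 κ :=
    add_nonneg (Finset.sum_nonneg fun k _ => abs_nonneg _) (mul_nonneg (abs_nonneg b) (ell0_nonneg hκ))
  change _ ≤ ∫ θ in Ioo (0 : ℝ) 1, |gFun κ a b θ|
  have c1 : min (min cL cN) (min cM₁ cM₂) ≤ cL := (min_le_left _ _).trans (min_le_left _ _)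
  have c2 : min (min cL cN) (min cM₁ cM₂) ≤ cN := (min_le_left _ _).trans (min_le_right _ _)
  have c3 : min (min cL cN) (min cM₁ cM₂) ≤ cM₁ := (min_le_right _ _).trans (min_le_left _ _)
  have c4 : min (min cL cN) (min cM₁ cM₂) ≤ cM₂ := (min_le_right _ _).trans (min_le_right _ _)
  rcases le_abs'.1 hηκ with h | h
  · rcases le_or_gt κ (-1 + ε) with h' | h'
    · exact (mul_le_mul_of_nonneg_right c2 hX).trans (hN κ hκ h' a b)
    · exact (mul_le_mul_of_nonneg_right c4 hX).trans (hM₂ κ ⟨h'.le, by linarith⟩ a b)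
  · rcases le_or_gt K κ with h' | h'
    · exact (mul_le_mul_of_nonneg_right c1 hX).trans (hL κ h' a b)
    · exact (mul_le_mul_of_nonneg_right c3 hX).trans (hM₁ κ ⟨h, h'.le⟩ a b)

end Away

/-- **The endpoint analysis of NODE-g8 §3, PROVED**: both lemmas, every degree, every `η > 0`. -/
theorem endpointAnalysis : EndpointAnalysis :=
  ⟨fun m _ hη => kernelIndependenceAway m hη, kernelIndependenceTaylor⟩

/-! ## How the prover uses the two lemmas: termwise integrability from the band's `L¹` fibre norm

Over a base cell (any measure space `(α, μ)`; the prover takes `μ = volume.restrict σ`), if the absolute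
fibre integral `A(x) = ∫₀¹ |Σ aₖ(x) θᵏ + b(x)·kernel(κ(x), θ)| dθ` is integrable and `κ(x)` stays in ONE
regime, then every coefficient `aₖ` and the weighted monomial coefficient are integrable (domination by
`A/c`).  Measurability of the coefficient functions is assumed (semialgebraic ⇒ measurable, prover-side). -/

section Use

variable {α : Type*} [MeasurableSpace α] {μ : Measure α} {m : ℕ}

end Use

end Plan

end RegularisedLogLayer

end Summit.KontsevichZagierPeriods.RootDecompRelativeModAbsolute.Rung30571

end
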